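import Summits.Ventures.CertifiedManyBodySolver.Downfold.BoxesNdNiO2ELadder
import HarnessLib

/-!
# NdNiO₂ object-E ladder, sequel B: the admitted `U` member line (6) (RULING R-me (c)) and the FLOOR READING OF RECORD
# (RULING R-mb (c)) typed for every entry of `boxNdNiO2E_M21`

Venture CertifiedManyBodySolver, cell `pub/hubbard-downfold` (S1; D-0154 (1) (C) COVERAGE (iii) NdNiO₂), seat hubbard-cov-ndnio2-unc-2. Sequel of
`BoxesNdNiO2ELadder.lean` (members → hulls → rungs → `divPos` → enclosure by `boxNdNiO2E_M21`). Two rulings of the lead (g13) landed after that file: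

* **R-me (c)** (STATUS 2026-08-28T05:38:52Z): «§U-MEMBERS line (6) ADMITTED INTERIOR: Karp–Hampel–Millis PRB 105 205131 (2022) arXiv:2201.10481 p.2 "U = 2.8 eV"
  (VASP cRPA, SLWF x²−y²) — no edge moves ([2.47, 3.2])». VERSION RULE ⇒ a NEW member set `ndNiO2_oneBandU_members_v2 = insert 28/10 (v1 set)`;
  §1 proves the new member is STRICTLY INTERIOR, the hull of record `[247/100, 16/5]` still encloses every member and is still LEAST (both ends are
  still members), and every enclosure door of the first file applies to the v2 set verbatim.
* **R-mb (c)** (STATUS 2026-08-28T05:20:27Z), THE FLOOR READING OF RECORD for every typed ladder: «a FLOOR rung is the pair of predicates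
  "entry ⊇ member hull" ∧ "entry half-width ≥ FLOOR" (relative FLOORs — FLOOR(t) 8 % — are taken against the ENTRY's own midpoint; absolute ones —
  FLOOR(tp/t) ±0.05, FLOOR(dsd) ±0.03 — as printed) … the entry is NOT defined as outward-round(hull-midpoint × (1 ± FLOOR)) … INFL-T +3 % … =
  "inflated entry ⊇ un-inflated entry widened by ≥ the stated amount on the stated side(s)". A genuine finding is only: a member of record OUTSIDE
  its printed entry, or an entry whose half-width is BELOW its stated FLOOR.» §2 types EXACTLY THAT pair for each of the five entries of
  `boxNdNiO2E_M21` (and for the `U_abs` and `dsd` rows the quotient / filling entries derive from) and concludes `boxNdNiO2E_M21_floorReading`: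
  ALL PASS ⇒ NO genuine finding on object E. READING CONSEQUENCE for the first file's §3: `ndNiO2E_tp_floor_not_le_entry` (the `floorTo`
  MIDPOINT construction `[−0.4575, −0.3575]` overshoots the typed `[−0.46, −0.36]` by `1/400` on the high side) is a true statement about mod-1's
  `floorTo`, NOT a finding under the reading of record — the typed entry has half-width EXACTLY `1/20 ≥ FLOOR(tp/t)` and encloses the member hull
  (RULING R-ma: sliver BOOKED, no box edit; `boxNdNiO2E_M21` is the typed object of record).

Everything PROVED (no `sorry`). HONEST FRAMING: containment / width arithmetic on SCREENING-GRADE and `[float]` rows typed verbatim; nothing about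
NdNiO₂ is certified; no hull move (R-me (c): interior admission), no word, no box edit.
-/

namespace Summit.Ventures.CertifiedManyBodySolver.Downfold

open NonemptyInterval

/-! ## §1 R-me (c): `U` member line (6) — Karp–Hampel–Millis 2022, `U = 2.8` eV, ADMITTED INTERIOR -/

/-- **Member line (6) of §U-MEMBERS (RULING R-me (c))**: `28/10` eV — one-band cRPA `U` for NdNiO₂, VASP, selectively-localised Wannier function
(SLWF) x²−y² correlated subspace, PBE, Nd-4f open core — Karp, Hampel, Millis, PRB 105 205131 (2022), arXiv:2201.10481 p.2 L93–99 «U = 2.8 eV for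
NdNiO₂» `[float]` (located by hubbard-cov-ndnio2-lit-1, dossier v1 F6; REFVALS-2.tsv l.722). [folklore] -/
def ndNiO2_oneBandU_KHM22 : ℚ := 28/10

/-- **The v2 member set** = line (6) inserted into the §U-MEMBERS v1 set of `BoxesNdNiO2ELadder` (VERSION RULE: the v1 set stays as typed). [folklore] -/
def ndNiO2_oneBandU_members_v2 : Finset ℚ := insert ndNiO2_oneBandU_KHM22 ndNiO2_oneBandU_members

/-- Line (6) is STRICTLY INTERIOR to the hull of record `[2.47, 3.2]` — «no edge moves» (R-me (c)). [folklore] -/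
theorem ndNiO2_oneBandU_KHM22_interior :
    ndNiO2_oneBandU_hull.fst < ndNiO2_oneBandU_KHM22 ∧ ndNiO2_oneBandU_KHM22 < ndNiO2_oneBandU_hull.snd := by
  simp only [ndNiO2_oneBandU_hull, ndNiO2_oneBandU_KHM22]; norm_num

/-- Every v2 member lies in the hull of record (v1 members by the first file, line (6) by interiority). [folklore] -/
theorem ndNiO2_oneBandU_members_v2_subset_hull :
    ∀ m ∈ ndNiO2_oneBandU_members_v2, ndNiO2_oneBandU_hull.fst ≤ m ∧ m ≤ ndNiO2_oneBandU_hull.snd := by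
  intro m hm
  rw [ndNiO2_oneBandU_members_v2, Finset.mem_insert] at hm
  rcases hm with rfl | hm
  · exact ⟨ndNiO2_oneBandU_KHM22_interior.1.le, ndNiO2_oneBandU_KHM22_interior.2.le⟩
  · exact ndNiO2_oneBandU_members_subset_hull m hm

/-- The hull of record is still LEAST for the v2 set: both of its ends are v2 members (the v1 edge members 2.47 / 3.2). [folklore] -/
theorem ndNiO2_oneBandU_hull_ends_mem_v2 :
    ndNiO2_oneBandU_hull.fst ∈ ndNiO2_oneBandU_members_v2 ∧ ndNiO2_oneBandU_hull.snd ∈ ndNiO2_oneBandU_members_v2 :=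
  ⟨Finset.mem_insert_of_mem ndNiO2_oneBandU_hull_ends_mem.1, Finset.mem_insert_of_mem ndNiO2_oneBandU_hull_ends_mem.2⟩

/-- The v1 set is contained in the v2 set (nothing was removed). [folklore] -/
theorem ndNiO2_oneBandU_members_subset_v2 : ndNiO2_oneBandU_members ⊆ ndNiO2_oneBandU_members_v2 :=
  Finset.subset_insert _ _

/-- **Enclosure door for the v2 set**: every v2 member divided by any enclosed `t_eff` is enclosed by `ndNiO2E_M21_U` (the §5 error-bar theorem of
the first file is a statement about the HULL, so it covers line (6) with no new arithmetic). [folklore] -/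
theorem ndNiO2E_M21_U_mem_of_member_v2_div {m : ℚ} (hm : m ∈ ndNiO2_oneBandU_members_v2) {t : ℝ} (ht : ndNiO2E_M21_t.Mem t) :
    ndNiO2E_M21_U.Mem ((m : ℝ) / t) := by
  have h := ndNiO2_oneBandU_members_v2_subset_hull m hm
  exact ndNiO2E_M21_U_mem_div (mem_ratCast_iff.2 ⟨by exact_mod_cast h.1, by exact_mod_cast h.2⟩) ht

/-- Line (6)'s own quotient range over the typed `t_eff` row: `2.8 / [0.38, 0.49] = [40/7, 140/19] ≈ [5.714, 7.368] ⊂ [5, 8.5]` (interior on both sides). [folklore] -/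
theorem ndNiO2_oneBandU_KHM22_quotient_interior :
    (5 : ℚ) < ndNiO2_oneBandU_KHM22 / (49/100) ∧ ndNiO2_oneBandU_KHM22 / (19/50) < 17/2 ∧
      ndNiO2_oneBandU_KHM22 / (49/100) = 40/7 ∧ ndNiO2_oneBandU_KHM22 / (19/50) = 140/19 := by
  simp only [ndNiO2_oneBandU_KHM22]; norm_num

/-! ## §2 R-mb (c): THE FLOOR READING OF RECORD, typed per entry of `boxNdNiO2E_M21` -/

/-- **`U_abs` row (the hull itself is the row; FLOOR(U-lit) 10 % relative)**: the row encloses the member hull (trivially: it IS the hull) and its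
half-width `73/200 = 0.365` is `≥ 10 %` of its own midpoint `567/200` (`= 0.2835`). [folklore] -/
theorem ndNiO2_oneBandU_floorReading :
    ndNiO2_oneBandU_hull ≤ ndNiO2_oneBandU_hull ∧ ndNiO2_oneBandU_hull.midpoint * (10/100) ≤ ndNiO2_oneBandU_hull.halfWidth := by
  refine ⟨le_rfl, ?_⟩
  simp only [ndNiO2_oneBandU_hull, NonemptyInterval.midpoint, NonemptyInterval.halfWidth]; norm_num

/-- **`t_eff` entry `[19/50, 49/100]` (FLOOR(t) 8 % relative to the ENTRY midpoint; INFL-T +3 % on the high side)**: (i) entry ⊇ member hull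
`[0.3836, 0.4688]`; (ii) half-width `11/200 = 0.055 ≥ 8 % × 0.435 = 87/2500 = 0.0348`; (iii) INFL-T side condition: entry high end `0.49 ≥ 0.4688 × 1.03 =
0.482864`. [folklore] -/
theorem ndNiO2E_M21_t_floorReading :
    ndNiO2E_t_hull ≤ ndNiO2E_M21_t.encl ∧ ndNiO2E_M21_t.encl.midpoint * (8/100) ≤ ndNiO2E_M21_t.encl.halfWidth ∧
      ndNiO2E_t_hull.snd * (103/100) ≤ ndNiO2E_M21_t.encl.snd := by
  refine ⟨ndNiO2E_t_hull_le_rung.trans ndNiO2E_t_rung_le_entry, ?_, ?_⟩ <;>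
    simp only [ndNiO2E_M21_t, ndNiO2E_t_hull, Entry.encl_ofEnds_fst, Entry.encl_ofEnds_snd, NonemptyInterval.midpoint,
      NonemptyInterval.halfWidth] <;> norm_num

/-- **`t'/t_eff` entry `[−23/50, −9/25]` (FLOOR(tp/t) ±0.05 absolute)**: (i) entry ⊇ member hull `[−0.455, −0.360]`; (ii) half-width EXACTLY `1/20 ≥ 1/20`.
By R-mb (c) this entry PASSES; the first file's `ndNiO2E_tp_floor_not_le_entry` concerns the `floorTo` midpoint construction, not the reading of record. [folklore] -/
theorem ndNiO2E_M21_tp_floorReading :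
    ndNiO2E_tp_hull ≤ ndNiO2E_M21_tp.encl ∧ (1/20 : ℚ) ≤ ndNiO2E_M21_tp.encl.halfWidth ∧ ndNiO2E_M21_tp.encl.halfWidth = 1/20 := by
  refine ⟨ndNiO2E_tp_hull_le_entry, ?_, ?_⟩ <;>
    simp only [ndNiO2E_M21_tp, Entry.encl_ofEnds_fst, Entry.encl_ofEnds_snd, NonemptyInterval.halfWidth] <;> norm_num

/-- **`dsd` row `[47/1000, 147/1000]` (INFL-4f class floor ±0.05 absolute, which dominates FLOOR(dsd) ±0.03)**: row ⊇ member hull `[0.064, 0.13]` and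
half-width EXACTLY `1/20`; and the **filling entry `[213/250, 477/500]` (FLOOR(n) ±0.01)**: entry ⊇ `1 −` row `= [0.853, 0.953]` and half-width
`51/1000 ≥ 1/100`. [folklore] -/
theorem ndNiO2E_M21_n_floorReading :
    (ndNiO2_dsd_hull ≤ ndNiO2_dsd_hull.floorTo (1/20) ∧ (ndNiO2_dsd_hull.floorTo (1/20)).halfWidth = 1/20) ∧
      (ndNiO2E_M21_n.encl.fst ≤ 1 - (ndNiO2_dsd_hull.floorTo (1/20)).snd ∧ 1 - (ndNiO2_dsd_hull.floorTo (1/20)).fst ≤ ndNiO2E_M21_n.encl.snd) ∧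
      (1/100 : ℚ) ≤ ndNiO2E_M21_n.encl.halfWidth := by
  refine ⟨⟨le_floorTo _ _, ?_⟩, ⟨?_, ?_⟩, ?_⟩
  · unfold NonemptyInterval.halfWidth; rw [ndNiO2_dsd_floor_ends.1, ndNiO2_dsd_floor_ends.2]; norm_num
  · rw [ndNiO2_dsd_floor_ends.2]; simp only [ndNiO2E_M21_n, Entry.encl_ofEnds_fst]; norm_num
  · rw [ndNiO2_dsd_floor_ends.1]; simp only [ndNiO2E_M21_n, Entry.encl_ofEnds_snd]; norm_num
  · simp only [ndNiO2E_M21_n, Entry.encl_ofEnds_fst, Entry.encl_ofEnds_snd, NonemptyInterval.halfWidth]; norm_num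

/-- **`U/t_eff` entry `[5, 17/2]` (R-ak: outward print of `divPos`; the v1.1 print also quoted FLOOR(U-lit) 10 % relative)**: (i) entry ⊇ the exact quotient
rung `[247/49, 160/19]`; (ii) half-width `7/4 ≥ 10 % × 27/4 = 27/40`. [folklore] -/
theorem ndNiO2E_M21_U_floorReading :
    ndNiO2E_UoverT_exact ≤ ndNiO2E_M21_U.encl ∧ ndNiO2E_M21_U.encl.midpoint * (10/100) ≤ ndNiO2E_M21_U.encl.halfWidth := by
  refine ⟨ndNiO2E_UoverT_exact_le_entry, ?_⟩
  simp only [ndNiO2E_M21_U, Entry.encl_ofEnds_fst, Entry.encl_ofEnds_snd, NonemptyInterval.midpoint, NonemptyInterval.halfWidth]; norm_num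

/-- **`t''/t_eff` entry `[0, 0]`**: object E has no third-neighbour term BY DEFINITION (START-HERE §2), so no member hull and no FLOOR apply; the
entry is the point `0` (typed for completeness of the five-entry reading). [folklore] -/
theorem ndNiO2E_M21_tpp_floorReading : ndNiO2E_M21_tpp.encl.fst = 0 ∧ ndNiO2E_M21_tpp.encl.snd = 0 := by
  simp only [ndNiO2E_M21_tpp, Entry.encl_ofEnds_fst, Entry.encl_ofEnds_snd]; norm_num

/-- **THE FLOOR READING OF RECORD ON `boxNdNiO2E_M21`: ALL ENTRIES PASS** (R-mb (c): «entry ⊇ member hull» ∧ «entry half-width ≥ FLOOR», INFL-T as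
«inflated entry ⊇ hull widened by the stated amount on the stated side») — hence, by the ruling's own criterion («a genuine finding is only: a member
of record OUTSIDE its printed entry, or an entry whose half-width is BELOW its stated FLOOR»), there is NO genuine finding on the object-E column M21,
including after the admission of `U` line (6). [folklore] -/
theorem boxNdNiO2E_M21_floorReading :
    (∀ m ∈ ndNiO2_oneBandU_members_v2, ndNiO2_oneBandU_hull.fst ≤ m ∧ m ≤ ndNiO2_oneBandU_hull.snd) ∧
      ndNiO2_oneBandU_hull.midpoint * (10/100) ≤ ndNiO2_oneBandU_hull.halfWidth ∧
      (ndNiO2E_t_hull ≤ ndNiO2E_M21_t.encl ∧ ndNiO2E_M21_t.encl.midpoint * (8/100) ≤ ndNiO2E_M21_t.encl.halfWidth ∧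
        ndNiO2E_t_hull.snd * (103/100) ≤ ndNiO2E_M21_t.encl.snd) ∧
      (ndNiO2E_tp_hull ≤ ndNiO2E_M21_tp.encl ∧ (1/20 : ℚ) ≤ ndNiO2E_M21_tp.encl.halfWidth) ∧
      (1/100 : ℚ) ≤ ndNiO2E_M21_n.encl.halfWidth ∧
      (ndNiO2E_UoverT_exact ≤ ndNiO2E_M21_U.encl ∧ ndNiO2E_M21_U.encl.midpoint * (10/100) ≤ ndNiO2E_M21_U.encl.halfWidth) :=
  ⟨ndNiO2_oneBandU_members_v2_subset_hull, ndNiO2_oneBandU_floorReading.2, ndNiO2E_M21_t_floorReading,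
    ⟨ndNiO2E_M21_tp_floorReading.1, ndNiO2E_M21_tp_floorReading.2.1⟩, ndNiO2E_M21_n_floorReading.2.2, ndNiO2E_M21_U_floorReading⟩

/-! ## §3 (append, same seat) THE DETERMINATION-HULL RUNG AS A TYPED SUB-BOX `boxNdNiO2E_M21det` ⊆ `boxNdNiO2E_M21`
The rung BEFORE every FLOOR / pad / print: `U/t_eff ∈ divPos(U hull, t_eff MEMBER hull) = [6175/1172, 8000/959] ≈ [5.2688, 8.3420]`,
`t'/t_eff ∈ [−91/200, −9/25]` (member hull), `n ∈ 1 − [8/125, 13/100] = [87/100, 117/125] = [0.87, 0.936]` (dsd member hull), `t_eff ∈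
[959/2500, 293/625]` (member hull), `t'' = 0`. PLANNING READING for the captain (NDNIO2-COVERAGE-PLAN v0.2 §2, `[float]` with plan-1's own
`tools/kin_corner.py`, bathtub `K(t', n)` vs bar 0.4779578): box-of-record corner `K(−0.46, 0.954) = 0.480998` (+0.64 %, the leaf has content)
but determination-hull corner `K(−0.455, 0.936) = 0.473843` (−0.86 %), `K(−0.46, 0.936) = 0.476529` (−0.30 %), `K(−0.455, 0.954) = 0.478352`
(+0.08 %) ⇒ the residual R′ of record lies ENTIRELY in padding territory (INFL-4f floor on dsd: n 0.936 → 0.954; FLOOR(tp/t) + print: t′ −0.455 →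
−0.46; INFL-T + print: U/t 5.27 → 5.0); a padding-free CONTROL word on `boxNdNiO2E_M21det` is kinematically in reach of a finer majorant table
(zero solve) — a fallback PRODUCT if V1 misses (plan F2), never a substitute for the leaf on the box of record. -/

/-- `U/t_eff` determination rung `[6175/1172, 8000/959] = [2.47/0.4688, 3.2/0.3836]` (U hull ÷ t_eff MEMBER hull; no INFL-T, no print). [folklore] -/
def ndNiO2E_M21det_U : Entry := Entry.ofEnds (6175/1172) (8000/959) (by norm_num) .screening
/-- `t'/t_eff` determination rung = the member hull `[−91/200, −9/25]`. [folklore] -/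
def ndNiO2E_M21det_tp : Entry := Entry.ofEnds (-91/200) (-9/25) (by norm_num) .screening
/-- `n` determination rung `= 1 − dsd member hull = [87/100, 117/125] = [0.87, 0.936]`. [folklore] -/
def ndNiO2E_M21det_n : Entry := Entry.ofEnds (87/100) (117/125) (by norm_num) .screening
/-- `t_eff` determination rung = the member hull `[959/2500, 293/625]` eV. [folklore] -/
def ndNiO2E_M21det_t : Entry := Entry.ofEnds (959/2500) (293/625) (by norm_num) .screening

/-- **`boxNdNiO2E_M21det`** — the DETERMINATION-HULL sub-box of column M21, object E (every entry = the un-padded rung; `t'' = 0`). [folklore] -/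
def boxNdNiO2E_M21det : OneBandBox := fun c =>
  match c with
  | .UOverT => some ndNiO2E_M21det_U
  | .tpOverT => some ndNiO2E_M21det_tp
  | .filling => some ndNiO2E_M21det_n
  | .tEV => some ndNiO2E_M21det_t
  | .tppOverT => some ndNiO2E_M21_tpp
  | _ => none

/-- The `U/t_eff` determination rung IS `divPos(U hull, t_eff member hull)` (closed form checked against the tree's `divPos`). [folklore] -/
theorem ndNiO2E_M21det_U_eq_divPos :
    (ndNiO2_oneBandU_hull.divPos ndNiO2E_t_hull (by simp only [ndNiO2E_t_hull]; norm_num)).fst = ndNiO2E_M21det_U.encl.fst ∧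
      (ndNiO2_oneBandU_hull.divPos ndNiO2E_t_hull (by simp only [ndNiO2E_t_hull]; norm_num)).snd = ndNiO2E_M21det_U.encl.snd := by
  have h := NonemptyInterval.divPos_ends_of_nonneg (I := ndNiO2_oneBandU_hull) (T := ndNiO2E_t_hull)
    (by simp only [ndNiO2E_t_hull]; norm_num) (by simp only [ndNiO2_oneBandU_hull]; norm_num)
  rw [h.1, h.2]
  simp only [ndNiO2_oneBandU_hull, ndNiO2E_t_hull, ndNiO2E_M21det_U, Entry.encl_ofEnds_fst, Entry.encl_ofEnds_snd]; norm_num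

/-- **`boxNdNiO2E_M21det ⊆ boxNdNiO2E_M21`** (every un-padded rung sits inside its printed entry: `[5.2688, 8.3420] ⊆ [5, 8.5]`, `[−0.455, −0.36] ⊆
[−0.46, −0.36]`, `[0.87, 0.936] ⊆ [0.852, 0.954]`, `[0.3836, 0.4688] ⊆ [0.38, 0.49]`). Every word on the box of record transfers DOWN to it. [folklore] -/
theorem boxNdNiO2E_M21det_refines_M21 : boxNdNiO2E_M21det.Refines boxNdNiO2E_M21 := by
  intro p hp
  have hU := (Entry.mem_ofEnds_iff _ _ _ _ _).1 (hp .UOverT ndNiO2E_M21det_U rfl)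
  have hS := (Entry.mem_ofEnds_iff _ _ _ _ _).1 (hp .tpOverT ndNiO2E_M21det_tp rfl)
  have hN := (Entry.mem_ofEnds_iff _ _ _ _ _).1 (hp .filling ndNiO2E_M21det_n rfl)
  have hT := (Entry.mem_ofEnds_iff _ _ _ _ _).1 (hp .tEV ndNiO2E_M21det_t rfl)
  have hP := (Entry.mem_ofEnds_iff _ _ _ _ _).1 (hp .tppOverT ndNiO2E_M21_tpp rfl)
  rw [boxNdNiO2E_M21_mem_iff]
  push_cast at hU hS hN hT hP ⊢
  refine ⟨?_, ?_, ?_, ?_, ?_, ?_, ?_, ?_, hP.1, hP.2⟩ <;> linarith [hU.1, hU.2, hS.1, hS.2, hN.1, hN.2, hT.1, hT.2]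

/-- Downward transfer: any word holding on `boxNdNiO2E_M21` holds on the determination-hull sub-box. [folklore] -/
theorem holdsOn_boxNdNiO2E_M21det_of_M21 {W : (OneBandCoord → ℝ) → Prop} (h : HoldsOn W boxNdNiO2E_M21) : HoldsOn W boxNdNiO2E_M21det :=
  h.of_refines boxNdNiO2E_M21det_refines_M21

/-- **Every un-padded determination is a member of `boxNdNiO2E_M21det`**: `U` in the one-band hull (v1 or v2 members), `t_eff` in the MEMBER hull,
`U/t_eff = U / t_eff`, `t'/t_eff` in the member hull, `n = 1 − dsd` with `dsd` in the dsd MEMBER hull, `t'' = 0`. [folklore] -/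
theorem ndNiO2E_M21det_mem_of_determination (p : OneBandCoord → ℝ) {U d : ℝ}
    (hU : U ∈ ndNiO2_oneBandU_hull.ratCast ℝ) (ht : p .tEV ∈ ndNiO2E_t_hull.ratCast ℝ) (hUt : p .UOverT = U / p .tEV)
    (htp : p .tpOverT ∈ ndNiO2E_tp_hull.ratCast ℝ) (hd : d ∈ ndNiO2_dsd_hull.ratCast ℝ) (hn : p .filling = 1 - d)
    (htpp : p .tppOverT = 0) : boxNdNiO2E_M21det.Mem p := by
  have hq := div_mem_Icc_ends (K := ℝ) (I := ndNiO2_oneBandU_hull) (T := ndNiO2E_t_hull)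
    (by simp only [ndNiO2E_t_hull]; norm_num) (by simp only [ndNiO2_oneBandU_hull]; norm_num) hU ht
  simp only [ndNiO2_oneBandU_hull, ndNiO2E_t_hull, Set.mem_Icc] at hq
  rw [mem_ratCast_iff] at ht htp hd
  simp only [ndNiO2E_t_hull, ndNiO2E_tp_hull, ndNiO2_dsd_hull] at ht htp hd
  intro i e hi
  cases i <;> simp only [boxNdNiO2E_M21det, Option.some.injEq, reduceCtorEq] at hi <;> subst hi <;>
    rw [Entry.Mem, mem_ratCast_iff] <;>
    simp only [ndNiO2E_M21det_U, ndNiO2E_M21det_tp, ndNiO2E_M21det_n, ndNiO2E_M21det_t, ndNiO2E_M21_tpp,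
      Entry.encl_ofEnds_fst, Entry.encl_ofEnds_snd]
  · rw [hUt]; push_cast at hq ⊢; exact ⟨by linarith [hq.1], by linarith [hq.2]⟩
  · push_cast at htp ⊢; exact ⟨by linarith [htp.1], by linarith [htp.2]⟩
  · rw [hn]; push_cast at hd ⊢; exact ⟨by linarith [hd.2], by linarith [hd.1]⟩
  · push_cast at ht ⊢; exact ⟨by linarith [ht.1], by linarith [ht.2]⟩
  · rw [htpp]; push_cast; exact ⟨le_rfl, le_rfl⟩

/-- Corners of the delivered S2 box of `boxNdNiO2E_M21det`: `(6175/1172, −91/200, 87/100)` / `(8000/959, −9/25, 117/125)`. [folklore] -/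
theorem ndNiO2E_M21det_s2LoHi :
    s2Lo ndNiO2E_M21det_U ndNiO2E_M21det_tp ndNiO2E_M21det_n = ![6175/1172, -91/200, 87/100] ∧
      s2Hi ndNiO2E_M21det_U ndNiO2E_M21det_tp ndNiO2E_M21det_n = ![8000/959, -9/25, 117/125] := by
  constructor <;> (ext i; fin_cases i <;> simp [s2Lo, s2Hi, ndNiO2E_M21det_U, ndNiO2E_M21det_tp, ndNiO2E_M21det_n])

/-- **Word door on `boxNdNiO2E_M21det`**: ANY predicate `W₁ (U/t) (t'/t) (n)` proved on the delivered box
`Set.Icc ![6175/1172, −91/200, 87/100] ![8000/959, −9/25, 117/125]` (order `(U/t, t'/t, n)`) holds on the sub-box — energy windows, stiffness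
ceilings (`ObsStiffnessSeqCeilingAt (θ 1) (θ 0) (θ 2) c`), anything of the `_word_Icc` shape. [folklore] -/
theorem boxNdNiO2E_M21det_word_of_s2Box {W : (Fin 3 → ℝ) → Prop}
    (hW : ∀ θ ∈ Set.Icc (![6175/1172, -91/200, 87/100] : Fin 3 → ℝ) ![8000/959, -9/25, 117/125], W θ) :
    HoldsOn (fun p : OneBandCoord → ℝ => W ![p .UOverT, p .tpOverT, p .filling]) boxNdNiO2E_M21det := by
  have h := holdsOn_of_forall_s2Box (B := boxNdNiO2E_M21det) (eU := ndNiO2E_M21det_U) (eS := ndNiO2E_M21det_tp)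
    (eN := ndNiO2E_M21det_n) rfl rfl rfl (W := W) (by rw [ndNiO2E_M21det_s2LoHi.1, ndNiO2E_M21det_s2LoHi.2]; exact hW)
  exact h

/-! ## §4 (append, same seat) RULING R-mm (a) (lead g14, 2026-08-28T06:52:36Z): `U` member lines (7) `2.85` and (8) `2.88` ADMITTED INTERIOR,
the adopted-practice `3.4` of a sibling composition is CLASS CONTEXT (not a member), hull `[2.47, 3.2]` UNCHANGED; the census sentence of record
«computed cRPA(0) members ∪ in-house ⊂ [2.47, 3.10]; the top (3.10, 3.2] is carried by the adopted member (3) alone» — typed. VERSION RULE: v3 set. -/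

/-- **Member line (7) (R-mm (a))**: `57/20 = 2.85` eV — NdNiO₂-specific (D)-class cRPA(0) `U` (wien2k PBE + MLWF, PBEsol-relaxed cell, Nd-4f in core) —
Kitatani, Si, Worm, Tomczak, Arita, Held, PRL 130 166002 (2023), arXiv:2207.14038 p.2 L106-107 «from our cRPA calculation for entangled bands: 2.85 eV for
NdNiO₂» `[float]` (located by cov-ndnio2-lit-1 g2, dossier v1.3 F9; re-opened here). [folklore] -/
def ndNiO2_oneBandU_KSW23 : ℚ := 57/20
/-- **Member line (8) (R-mm (a))**: `72/25 = 2.88` eV — (D)-class FPLMTO-LDA cRPA(0) `U` of LaNiO₂ at the PrNiO₂-relaxed cell (La-proxy, cell tagged), P = 0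
entry of SM Table II «U [eV] 2.88 2.88 2.88 2.96 2.93» at «0 / 12.1 / 20 / 50 / 100 GPa» — Di Cataldo, Worm, Tomczak, Si, Held, Nat. Commun. 15 3952 (2024),
arXiv:2311.06195 SM p.12 L45-46 `[float]` (its P-flatness is P-LEVER CONTEXT, not a column of box #20). [folklore] -/
def ndNiO2_oneBandU_DWT24 : ℚ := 72/25
/-- **CLASS CONTEXT, NOT a member (R-mm (a), rule (ii))**: `17/5 = 3.4` eV — «we use a fixed U = 3.4 eV» for the PrNiO₂ single-band model (arXiv:2311.06195
SM p.12 L41; text p.3 L27): an ADOPTED-PRACTICE value (cRPA + the authors' beyond-cRPA allowance) for a SIBLING composition. [folklore] -/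
def ndNiO2_oneBandU_DWT24adopted_context : ℚ := 17/5

/-- **The v3 member set** = lines (7), (8) inserted into the v2 set (VERSION RULE: v1 / v2 sets stay as typed). [folklore] -/
def ndNiO2_oneBandU_members_v3 : Finset ℚ := insert ndNiO2_oneBandU_KSW23 (insert ndNiO2_oneBandU_DWT24 ndNiO2_oneBandU_members_v2)

/-- Lines (7) and (8) are STRICTLY INTERIOR to the hull of record `[2.47, 3.2]` — «no edge» (R-mm (a)); and they lie at or below the in-house (D) 26-Ry
member `3.10`, so the top `(3.10, 3.2]` of the hull still holds the adopted member (3) `3.2` alone. [folklore] -/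
theorem ndNiO2_oneBandU_lines78_interior :
    (ndNiO2_oneBandU_hull.fst < ndNiO2_oneBandU_KSW23 ∧ ndNiO2_oneBandU_KSW23 < ndNiO2_oneBandU_hull.snd) ∧
      (ndNiO2_oneBandU_hull.fst < ndNiO2_oneBandU_DWT24 ∧ ndNiO2_oneBandU_DWT24 < ndNiO2_oneBandU_hull.snd) ∧
      ndNiO2_oneBandU_KSW23 ≤ 31/10 ∧ ndNiO2_oneBandU_DWT24 ≤ 31/10 := by
  simp only [ndNiO2_oneBandU_hull, ndNiO2_oneBandU_KSW23, ndNiO2_oneBandU_DWT24]; norm_num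

/-- Every v3 member lies in the hull of record; both hull ends are still v3 members (the hull is still LEAST); v2 ⊆ v3 (nothing removed). [folklore] -/
theorem ndNiO2_oneBandU_members_v3_subset_hull :
    (∀ m ∈ ndNiO2_oneBandU_members_v3, ndNiO2_oneBandU_hull.fst ≤ m ∧ m ≤ ndNiO2_oneBandU_hull.snd) ∧
      (ndNiO2_oneBandU_hull.fst ∈ ndNiO2_oneBandU_members_v3 ∧ ndNiO2_oneBandU_hull.snd ∈ ndNiO2_oneBandU_members_v3) ∧
      ndNiO2_oneBandU_members_v2 ⊆ ndNiO2_oneBandU_members_v3 := by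
  refine ⟨?_, ⟨?_, ?_⟩, ?_⟩
  · intro m hm
    rw [ndNiO2_oneBandU_members_v3, Finset.mem_insert, Finset.mem_insert] at hm
    rcases hm with rfl | rfl | hm
    · exact ⟨ndNiO2_oneBandU_lines78_interior.1.1.le, ndNiO2_oneBandU_lines78_interior.1.2.le⟩
    · exact ⟨ndNiO2_oneBandU_lines78_interior.2.1.1.le, ndNiO2_oneBandU_lines78_interior.2.1.2.le⟩
    · exact ndNiO2_oneBandU_members_v2_subset_hull m hm
  · exact Finset.mem_insert_of_mem (Finset.mem_insert_of_mem ndNiO2_oneBandU_hull_ends_mem_v2.1)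
  · exact Finset.mem_insert_of_mem (Finset.mem_insert_of_mem ndNiO2_oneBandU_hull_ends_mem_v2.2)
  · exact (Finset.subset_insert _ _).trans (Finset.subset_insert _ _)

/-- **THE CENSUS SENTENCE OF RECORD (R-mm (a)), typed**: every v3 member is `≥ 247/100` and is EITHER `≤ 31/10` OR the adopted member (3) `16/5` — the computed
cRPA(0) determinations `{2.578, 2.608, 2.8, 2.85, 2.88, 2.910}` and the in-house `{2.47, 3.10}` lie in `[2.47, 3.10]`, so the top `(31/10, 16/5]` of the hull is
carried by `16/5` alone (SAID, of record; no edge consequence: «1BH» is decided at the LOW-`U` end). [folklore] -/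
theorem ndNiO2_oneBandU_census_v3 :
    ∀ m ∈ ndNiO2_oneBandU_members_v3, (247/100 : ℚ) ≤ m ∧ (m ≤ 31/10 ∨ m = 16/5) := by
  intro m hm
  simp only [ndNiO2_oneBandU_members_v3, ndNiO2_oneBandU_members_v2, ndNiO2_oneBandU_members, ndNiO2_oneBandU_KSW23,
    ndNiO2_oneBandU_DWT24, ndNiO2_oneBandU_KHM22, Finset.mem_insert, Finset.mem_singleton] at hm
  rcases hm with rfl | rfl | rfl | rfl | rfl | rfl | rfl | rfl | rfl <;> norm_num

/-- **The context value `3.4` is NOT in the hull** — it lies ABOVE the high end `3.2` by `1/5`; admitting it would have been an EDGE event (why rule (ii) keeps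
sibling-composition allowances out), unlike lines (7)/(8). [folklore] -/
theorem ndNiO2_oneBandU_DWT24adopted_not_mem :
    ¬ (ndNiO2_oneBandU_hull.fst ≤ ndNiO2_oneBandU_DWT24adopted_context ∧ ndNiO2_oneBandU_DWT24adopted_context ≤ ndNiO2_oneBandU_hull.snd) ∧
      ndNiO2_oneBandU_DWT24adopted_context - ndNiO2_oneBandU_hull.snd = 1/5 := by
  simp only [ndNiO2_oneBandU_hull, ndNiO2_oneBandU_DWT24adopted_context]; norm_num

/-- **Enclosure door for the v3 set**: every v3 member divided by any enclosed `t_eff` is enclosed by `ndNiO2E_M21_U` (hull statement, no new arithmetic);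
the new lines' own quotient ranges over the typed `t_eff` row are `2.85/[0.38, 0.49] = [285/49, 15/2]` and `2.88/[0.38, 0.49] = [288/49, 144/19]`, both
interior of `[5, 17/2]`. [folklore] -/
theorem ndNiO2E_M21_U_mem_of_member_v3_div {m : ℚ} (hm : m ∈ ndNiO2_oneBandU_members_v3) {t : ℝ} (ht : ndNiO2E_M21_t.Mem t) :
    ndNiO2E_M21_U.Mem ((m : ℝ) / t) ∧
      ((5 : ℚ) < 285/49 ∧ ndNiO2_oneBandU_KSW23 / (49/100) = 285/49 ∧ ndNiO2_oneBandU_KSW23 / (19/50) = 15/2 ∧ (15/2 : ℚ) < 17/2) ∧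
      ((5 : ℚ) < 288/49 ∧ ndNiO2_oneBandU_DWT24 / (49/100) = 288/49 ∧ ndNiO2_oneBandU_DWT24 / (19/50) = 144/19 ∧ (144/19 : ℚ) < 17/2) := by
  have h := ndNiO2_oneBandU_members_v3_subset_hull.1 m hm
  refine ⟨ndNiO2E_M21_U_mem_div (mem_ratCast_iff.2 ⟨by exact_mod_cast h.1, by exact_mod_cast h.2⟩) ht, ?_, ?_⟩ <;>
    simp only [ndNiO2_oneBandU_KSW23, ndNiO2_oneBandU_DWT24] <;> norm_num

end Summit.Ventures.CertifiedManyBodySolver.Downfold
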